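import Mathlib
import HarnessLib

/-!
# Joshi, ATS III §11 «Appendix II: Perfect Frobenioids vs. Perfectoids» — multiplicatoids (slot T-54)

Record-only TYPING file of the abc-iut cell, block E («type Joshi's construction, test vs S», rung LADDER-ABC:A2.E), seat
abc-iut-E-t11, slot T-54 of `HOME/plan/E/ASSIGNMENTS.md` v2 (node ids J3:Prop11.1.1, J3:Rmk11.1.2, J3:Rmk11.2.1, J3:Thm11.4.1,
J3:Thm11.7.1 (1)(2)(3), J3:Rmk11.8.1 (1)(2), J3:Rmk11.8.2, J3:Rmk11.8.3 and the un-numbered §11 ADD rows of the locator inventory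
`HOME/plan/E/t39/INVENTORY.tsv` by abc-iut-E-t39, reader of record). Source: K. Joshi, *Construction of Arithmetic Teichmüller
Spaces III*, arXiv:2401.13508 **v4** (unrefereed, «Preliminary version for comments») = bib `Joshi2024ATS3`; §11 = PDF pp. 142–145
of the cell's render `HOME/lit/renders/Joshi-arxiv-2401.13508/pNNNN.txt` («p.N l.a–b» = lines a–b of that page file). Spine App,
class P4: §11 is cited by NO node on a path to Thm. 9.11.1 / Cor. 9.11.1.1 / S (E-t39's finding; JOSHI-DAG `cited_by = 0`) — this
file is registry completeness, not test material. TAKES NO SIDE on [IUTchIII] Cor. 3.12, on Joshi's claims, on his sentences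
about [IUTchI–IV] / [Mochizuki 2008] quoted below, or on Mochizuki's report; typed ≠ proved; typed AS A CANDIDATE ≠ endorsed.
Statements Joshi ASSERTS are `Prop`-valued `def`s tagged `@[claim "Joshi2024ATS3" "disputed"]` («disputed» = the registered
status word recording that a dispute exists in print, E-PLAN R6), never asserted; what FOLLOWS from the typed definitions is a
proved `theorem`. Nothing of OUR interface is imported (no Frobenioid / scheme-level monoid object of ours is comparable;
nearest vocabulary: the [FrdI] rows of plan/DAG.tsv, untyped).

CONTENTS
* §11.1 Prop. 11.1.1 (p.142 l.13–28): the PERFECTION `O*pf = lim←_n (O*, x ↦ xⁿ)` typed CONCRETELY on a commutative group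
  (`MulPerfection A`: compatible families over the positive integers ordered by divisibility; print's «`n ∈ ℤ≥0`» is read as
  `n ≥ 1` — with `n = 0` the transition `x ↦ x⁰` is degenerate; flagged for E-ref) and on a presheaf of commutative groups over a
  preorder of opens (`UnitsPresheaf`, restriction homomorphisms; `perfection`). The DERIVABLE core of the Proposition is PROVED:
  the perfection is UNIQUELY DIVISIBLE (`pow_bijective`: every `k`-th power map is a bijection — «perfect monoids in the sense of
  [Mochizuki 2008] … i.e. the stalks are ℚ-vector spaces»), functorial (`map`), and again a presheaf. The SHEAF clause («limits of
  sheaves of abelian groups … are sheaves», proof l.27–28; [Stacks 009F]) is a locator only: no site / gluing is typed here.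
  The additive perfection `(O_X,+)pf` (p.142 l.29–35) = `MulPerfection (Multiplicative ·)` (`AddPerfection`); `K*pf` (l.36–39) =
  the same functor on the unit groups of the function fields (docstring).
* §11.2 (p.143 l.1–9): the PERFECT MULTIPLICATOID `(X, O*pf_X)` / ADDITIVOID of `(X, O_X)` = `perfection` of the units presheaf
  on `Opens X` (`perfectMultiplicatoidOf`); Rmk. 11.2.1 (p.143 l.10–29) the one-point examples `(|Spec L̄|, L̄*pf)`, `(|Spec ℚ̄_p|, ℚ̄_p*pf)` =
  `fieldMultiplicatoid` (the attribution sentences about [Mochizuki 2008] / [IUTchI–IV] are quoted, not typed).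
* §11.3 (p.143 l.30–47): the BASIC PROBLEM (11.3.1) — isomorphisms of pairs `(Y, O*pf_Y) ≃ (X, O*pf_X)` — as the structure `PairIso`
  (homeomorphism + sectionwise group isomorphisms compatible with restriction) and the relation `SolvesBasicProblem`.
* §11.4 Thm. 11.4.1 (p.143 l.52–64): amphoricity of `(|Spec k̄|, k̄*pf)` from the topological group `G_k` — claim-Prop `Thm1141` over a
  family of fields with their absolute Galois groups (typed core: a topological-group isomorphism `G_{k₁} ≃ G_{k₂}` yields an
  isomorphism `k̄₁*pf ≃ k̄₂*pf`; «functorial in `k`» recorded in the docstring).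
* §11.7 Thm. 11.7.1 (1)(2)(3) (p.144 l.13 – p.145 l.16): claim-Props over an abstract untilt-class datum (Mathlib has the tilt of a
  perfectoid FIELD only, `PreTilt`; no perfectoid spaces, no `|X| ≃ |X♭|`, no `π₁^ét`): (1) `Thm1171_1` homeomorphism of pairs
  (space, `p`-perfection monoid presheaf), (2) `Thm1171_2` non-isomorphic untilts with (1) ([Kedlaya–Temkin 2018]; cf. E-t1's
  [J-I] untilt-existence claims — NOT restated here, the relation «isomorphic as perfectoid spaces» is an abstract parameter),
  (3) `Thm1171_3` `π₁^ét(X) ≃ π₁^ét(Y)`.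
* §11.5, §11.6, Rmk. 11.1.2, Rmk. 11.8.1–11.8.3: expository / interpretive sentences (incl. sentences about [IUTchI–IV],
  [Mochizuki 2022], [Scholze 2014]) — quoted in the closing section docstring as E6-style attach points; no typable assertion.
-/

noncomputable section

open Set TopologicalSpace

namespace Summit.ABC.IUTFork.Joshi.ATS3.Multiplicatoids

/-! ## §11.1 The perfection of a commutative group and Proposition 11.1.1 -/

/-- **The perfection `A^{pf} = lim←_n (A, x ↦ xⁿ)` of a commutative group** — the group-level core of [J-III] Prop. 11.1.1 (p.142
l.13–21: «for each `n` let `φ_n : O*_X → O*_X` be the homomorphism … `x ↦ xⁿ`. Consider the (inverse) limit presheaf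
`O*pf_X = lim←_n (O*_X, φ_n)`»): the subgroup of `ℕ⁺ → A` of COMPATIBLE FAMILIES `(a_n)_{n ≥ 1}`, `a_n^{n/m} = a_m` whenever `m ∣ n`
(the inverse system over the positive integers ordered by divisibility; print's «`n ∈ ℤ≥0`» read as `n ≥ 1`).
[claim: Joshi2024ATS3, status: disputed] -/
def MulPerfection (A : Type*) [CommGroup A] : Subgroup (ℕ+ → A) where
  carrier := {a | ∀ (m n : ℕ+) (k : ℕ), (n : ℕ) = m * k → a n ^ k = a m}
  one_mem' := fun m n k _ => by simp
  mul_mem' := fun {a b} ha hb m n k h => by simp only [Pi.mul_apply, mul_pow, ha m n k h, hb m n k h]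
  inv_mem' := fun {a} ha m n k h => by simp only [Pi.inv_apply, inv_pow, ha m n k h]

/-- The additive perfection `(A,+)^{pf} = lim←_n (A, x ↦ n·x)` (p.142 l.29–35: «`(O_X,+)pf = lim←_n (O_X,+)` … over … `x ↦ n·x` … a
sheaf of perfect monoids in the sense of [Mochizuki, 2008]»): the multiplicative perfection of `Multiplicative A`.
[claim: Joshi2024ATS3, status: disputed] -/
abbrev AddPerfection (A : Type*) [AddCommGroup A] : Subgroup (ℕ+ → Multiplicative A) := MulPerfection (Multiplicative A)

namespace MulPerfection

variable {A B C : Type*} [CommGroup A] [CommGroup B] [CommGroup C]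

/-- Membership: the compatibility `a_n^k = a_m` for `n = m·k`. [folklore] -/
theorem mem_iff (a : ℕ+ → A) : a ∈ MulPerfection A ↔ ∀ (m n : ℕ+) (k : ℕ), (n : ℕ) = m * k → a n ^ k = a m := Iff.rfl

/-- The projections `A^{pf} → A`, `(a_n) ↦ a_m` (the structure maps of the limit). [claim: Joshi2024ATS3, status: disputed] -/
def proj (m : ℕ+) : MulPerfection A →* A := (Pi.evalMonoidHom (fun _ => A) m).comp (MulPerfection A).subtype

/-- `proj m a = a m`. [folklore] -/
theorem proj_apply (m : ℕ+) (a : MulPerfection A) : proj m a = (a : ℕ+ → A) m := rfl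

/-- Compatibility of the projections with the transition maps: `(a_{m·k})^k = a_m`. [folklore] -/
theorem proj_mul_pow (m k : ℕ+) (a : MulPerfection A) : proj (m * k) a ^ (k : ℕ) = proj m a :=
  a.2 m (m * k) k (PNat.mul_coe m k)

/-- The `k`-th ROOT of a compatible family: `(a_{k·n})_n`. [folklore] -/
def root (k : ℕ+) (a : MulPerfection A) : MulPerfection A :=
  ⟨fun n => (a : ℕ+ → A) (k * n), fun m n j h => a.2 (k * m) (k * n) j (by rw [PNat.mul_coe, PNat.mul_coe, h, mul_assoc])⟩

/-- `(root k a)_n = a_{k·n}`. [folklore] -/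
theorem root_apply (k n : ℕ+) (a : MulPerfection A) : (root k a : ℕ+ → A) n = (a : ℕ+ → A) (k * n) := rfl

/-- `(root k a)^k = a`: every element has a `k`-th root (DIVISIBILITY). [folklore] -/
theorem root_pow (k : ℕ+) (a : MulPerfection A) : root k a ^ (k : ℕ) = a := by
  refine Subtype.ext (funext fun n => ?_)
  show (a : ℕ+ → A) (k * n) ^ (k : ℕ) = (a : ℕ+ → A) n
  exact a.2 n (k * n) k (by rw [PNat.mul_coe, mul_comm])

/-- TORSION-FREENESS: `b^k = 1 ⟹ b = 1` in the perfection (`b_n = (b_{k·n})^k = (b^k)_{k·n} = 1`). [folklore] -/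
theorem eq_one_of_pow_eq_one {k : ℕ+} {b : MulPerfection A} (h : b ^ (k : ℕ) = 1) : b = 1 := by
  refine Subtype.ext (funext fun n => ?_)
  have hk : (b : ℕ+ → A) (n * k) ^ (k : ℕ) = (b : ℕ+ → A) n := b.2 n (n * k) k (PNat.mul_coe n k)
  have h' : ((b ^ (k : ℕ) : MulPerfection A) : ℕ+ → A) (n * k) = 1 := by rw [h]; rfl
  rw [← hk]
  exact h'

/-- `root k` is a left and right inverse of the `k`-th power map: `root k (a^k) = a`. [folklore] -/
theorem root_pow_eq (k : ℕ+) (a : MulPerfection A) : root k (a ^ (k : ℕ)) = a := by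
  have h1 : (root k (a ^ (k : ℕ))) ^ (k : ℕ) = a ^ (k : ℕ) := root_pow k _
  have h2 : (root k (a ^ (k : ℕ)) * a⁻¹) ^ (k : ℕ) = 1 := by rw [mul_pow, h1, inv_pow, mul_inv_cancel]
  exact mul_inv_eq_one.1 (eq_one_of_pow_eq_one h2)

/-- **The DERIVABLE core of [J-III] Prop. 11.1.1, PROVED**: the perfection is UNIQUELY DIVISIBLE — every `k`-th power map
(`k ≥ 1`) is a bijection («perfect monoids in the sense of [Mochizuki, 2008]. Notably the stalks … are perfect monoids i.e. the
stalks are ℚ-vector spaces», p.142 l.22–26; a uniquely divisible abelian group is a ℚ-vector space). [claim: Joshi2024ATS3, status: disputed] -/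
theorem pow_bijective (k : ℕ+) : Function.Bijective fun a : MulPerfection A => a ^ (k : ℕ) :=
  ⟨fun a b h => by rw [← root_pow_eq k a, ← root_pow_eq k b]; exact congrArg (root k) h, fun a => ⟨root k a, root_pow k a⟩⟩

/-- FUNCTORIALITY: a homomorphism `f : A → B` induces `A^{pf} → B^{pf}` coordinatewise (it commutes with the transition maps
`x ↦ xⁿ`) — how restriction maps of `O*_X` pass to `O*pf_X`. [claim: Joshi2024ATS3, status: disputed] -/
def map (f : A →* B) : MulPerfection A →* MulPerfection B where
  toFun a := ⟨fun n => f ((a : ℕ+ → A) n), fun m n k h => by rw [← map_pow, a.2 m n k h]⟩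
  map_one' := Subtype.ext (funext fun _ => map_one f)
  map_mul' a b := Subtype.ext (funext fun n => map_mul f ((a : ℕ+ → A) n) ((b : ℕ+ → A) n))

/-- `(map f a)_n = f (a_n)`. [folklore] -/
theorem map_apply (f : A →* B) (a : MulPerfection A) (n : ℕ+) : (map f a : ℕ+ → B) n = f ((a : ℕ+ → A) n) := rfl

/-- `map id = id`. [folklore] -/
theorem map_id : map (MonoidHom.id A) = MonoidHom.id (MulPerfection A) :=
  MonoidHom.ext fun _ => Subtype.ext (funext fun _ => rfl)

/-- `map (g ∘ f) = map g ∘ map f`. [folklore] -/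
theorem map_comp (g : B →* C) (f : A →* B) : map (g.comp f) = (map g).comp (map f) :=
  MonoidHom.ext fun _ => Subtype.ext (funext fun _ => rfl)

/-- `map` commutes with the projections. [folklore] -/
theorem proj_map (f : A →* B) (m : ℕ+) (a : MulPerfection A) : proj m (map f a) = f (proj m a) := rfl

end MulPerfection

/-- **A presheaf of units** — the data `(O*_X, restrictions)` of a scheme / analytic space that §11 reads, over an abstract
preorder `Open` of open subsets (use: `Open = Opens X`): commutative groups of sections `F U` and restriction homomorphisms
for `U ≤ V`, functorial. Parameters, not instance fields (typer lint). SIGNATURE only; no scheme is constructed (slot T-05 /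
T-34 own the geometric carriers). [claim: Joshi2024ATS3, status: disputed] -/
structure UnitsPresheaf (Open : Type*) [Preorder Open] (F : Open → Type*) [∀ U, CommGroup (F U)] where
  /-- restriction `F V → F U` for `U ≤ V` -/
  res : ∀ {U V : Open}, U ≤ V → (F V →* F U)
  /-- `res` along `U ≤ U` is the identity -/
  res_self : ∀ U : Open, res (le_refl U) = MonoidHom.id (F U)
  /-- `res` is transitive -/
  res_comp : ∀ {U V W : Open} (hUV : U ≤ V) (hVW : V ≤ W), (res hUV).comp (res hVW) = res (hUV.trans hVW)

namespace UnitsPresheaf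

variable {Open : Type*} [Preorder Open] {F : Open → Type*} [∀ U, CommGroup (F U)] (P : UnitsPresheaf Open F)

/-- **`O*pf` as a presheaf** ([J-III] Prop. 11.1.1, «the (inverse) limit presheaf `O*pf_X = lim←_n (O*_X, φ_n)`», p.142 l.17–21): the
sectionwise perfection with the induced restrictions. The SHEAF property asserted in Prop. 11.1.1 («`O*pf_X` is a sheaf of abelian
groups»; proof: «limits of sheaves of abelian groups … are sheaves», l.27–28) is NOT typed here (no gluing datum); recorded as a
locator. [claim: Joshi2024ATS3, status: disputed] -/
def perfection : UnitsPresheaf Open fun U => MulPerfection (F U) where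
  res h := MulPerfection.map (P.res h)
  res_self U := by rw [P.res_self]; exact MulPerfection.map_id
  res_comp hUV hVW := by rw [← MulPerfection.map_comp, P.res_comp]

/-- The sections of the perfected presheaf are uniquely divisible (Prop. 11.1.1 «sections over open subsets (and hence also
stalks) are perfect monoids», p.142 l.22–24) — PROVED, over every open. [claim: Joshi2024ATS3, status: disputed] -/
theorem perfection_pow_bijective (_P : UnitsPresheaf Open F) (U : Open) (k : ℕ+) :
    Function.Bijective fun a : MulPerfection (F U) => a ^ (k : ℕ) :=
  MulPerfection.pow_bijective k

end UnitsPresheaf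

/-- **[J-III] Proposition 11.1.1 (p.142 l.13–26), AS PRINTED**: «Let `X/k` be a geometrically connected, smooth, quasi-projective variety over a
field `k`. … Consider the (inverse) limit presheaf `O*pf_X = lim←_n (O*_X, φ_n)`. Then `O*pf_X` is a sheaf of abelian groups whose sections
over open subsets (and hence also stalks) are perfect monoids in the sense of [Mochizuki, 2008]. Notably the stalks of `O*pf_X` are
perfect monoids i.e. the stalks are ℚ-vector spaces.» Typed over a units presheaf `P` on the opens of a topological space as the
conjunction: (sections) every `O*pf_X(U)` is uniquely divisible — PROVED (`prop1111_sections`); (sheaf) the limit presheaf satisfies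
the sheaf condition — carried as the abstract clause `sheafClause` supplied by the user of the signature (locator: «limits of
sheaves are sheaves», [Stacks 009F]; not formalised). A `Prop`-valued definition, NOT asserted. -/
@[claim "Joshi2024ATS3" "disputed"]
def Prop1111 {X : Type*} [TopologicalSpace X] {F : Opens X → Type*} [∀ U, CommGroup (F U)] (_P : UnitsPresheaf (Opens X) F)
    (sheafClause : Prop) : Prop :=
  (∀ (U : Opens X) (k : ℕ+), Function.Bijective fun a : MulPerfection (F U) => a ^ (k : ℕ)) ∧ sheafClause

/-- The sections clause of Prop. 11.1.1 HOLDS over the typed perfection; so, as typed, the Proposition reduces to its sheaf clause.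
[claim: Joshi2024ATS3, status: disputed] -/
theorem prop1111_iff_sheafClause {X : Type*} [TopologicalSpace X] {F : Opens X → Type*} [∀ U, CommGroup (F U)]
    (P : UnitsPresheaf (Opens X) F) (sheafClause : Prop) : Prop1111 P sheafClause ↔ sheafClause :=
  ⟨fun h => h.2, fun h => ⟨fun U k => P.perfection_pow_bijective U k, h⟩⟩

/-! ## §11.2 Multiplicatoids, additivoids; Remark 11.2.1 -/

/-- **[J-III] §11.2 (p.143 l.1–9), the PERFECT MULTIPLICATOID of `(X, O_X)`**: «Instead of working with the scheme structure `(X, O_X)`, one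
can work with the pair `(X, O*pf_X)`. I call `(X, O*pf_X)` the perfect multiplicatoid of the scheme `(X, O_X)`. Similarly, one calls the pair
`(X, (O_X,+)pf)`, the additivoid of `X`. One may think of [them] as a decoupling of the multiplication and addition structures of the
scheme.» Typed: the perfection of the units presheaf on `Opens X` (the space `X` is unchanged); the additivoid is the same
construction applied to `Multiplicative (O_X(U),+)` (`AddPerfection`). [claim: Joshi2024ATS3, status: disputed] -/
def perfectMultiplicatoidOf {X : Type*} [TopologicalSpace X] {F : Opens X → Type*} [∀ U, CommGroup (F U)]
    (P : UnitsPresheaf (Opens X) F) : UnitsPresheaf (Opens X) fun U => MulPerfection (F U) :=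
  P.perfection

/-- **[J-III] Remark 11.2.1 (p.143 l.10–29), the one-point examples**: for `X = Spec(L̄)`, `L̄` an algebraic closure of a number field, the
multiplicatoid `(|Spec(L̄)|, L̄*pf)` («`|Spec(L̄)|` … a one point topological space»), and for a prime `p` the multiplicatoid
`(|Spec(ℚ̄_p)|, ℚ̄_p*pf)`. On a one-point space the datum is the perfection of the unit group of the field. Print adds: «implicitly
considered in [Mochizuki, 2008] and importantly in [Mochizuki, 2021a,b,c,d]» / «of fundamental importance in [Mochizuki,
2021a,b,c,d]» — attribution sentences, quoted not typed. [claim: Joshi2024ATS3, status: disputed] -/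
abbrev fieldMultiplicatoid (L : Type*) [Field L] : Subgroup (ℕ+ → Lˣ) := MulPerfection Lˣ

/-- The field multiplicatoid is uniquely divisible (Prop. 11.1.1's core at a one-point space). [folklore] -/
theorem fieldMultiplicatoid_pow_bijective (L : Type*) [Field L] (k : ℕ+) :
    Function.Bijective fun a : fieldMultiplicatoid L => a ^ (k : ℕ) :=
  MulPerfection.pow_bijective k

/-! ## §11.3 The basic problem (11.3.1) -/

/-- **An isomorphism of pairs `(Y, O*pf_Y) ≃ (X, O*pf_X)`** — the shape of display (11.3.1) ([J-III] §11.3, p.143 l.33–37: «consider the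
problem of finding schemes `(Y, O_Y)` with isomorphisms between their multiplicatoids»): a homeomorphism `h : X ≃ Y` together
with group isomorphisms of sections `G(V) ≃ F(h⁻¹V)` compatible with restriction. Print does not spell out the morphisms of
such pairs; this is the evident notion (flag for E-ref). [claim: Joshi2024ATS3, status: disputed] -/
structure PairIso {X Y : Type*} [TopologicalSpace X] [TopologicalSpace Y] {F : Opens X → Type*} {G : Opens Y → Type*}
    [∀ U, CommGroup (F U)] [∀ V, CommGroup (G V)] (P : UnitsPresheaf (Opens X) F) (Q : UnitsPresheaf (Opens Y) G) where
  /-- the homeomorphism of underlying spaces -/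
  homeo : X ≃ₜ Y
  /-- the isomorphisms of sections over `V ⊂ Y` and its preimage `h⁻¹ V ⊂ X` -/
  iso : ∀ V : Opens Y, G V ≃* F (Opens.comap (homeo : C(X, Y)) V)
  /-- compatibility with restriction -/
  iso_res : ∀ {V V' : Opens Y} (h : V ≤ V') (s : G V'),
    iso V (Q.res h s) = P.res (OrderHomClass.mono (Opens.comap (homeo : C(X, Y))) h) (iso V' s)

/-- **[J-III] §11.3, the BASIC PROBLEM (11.3.1) (p.143 l.30–47)**: «Given the multiplicatoid of `X`, recover or reconstruct some scheme
structure on `X` compatible with this multiplicative structure … the problem of finding schemes `(Y, O_Y)` with isomorphisms between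
their multiplicatoids `(Y, O*pf_Y) ≃ (X, O*pf_X)` (11.3.1). More generally, if `M_X ⊆ K*pf_X` [is] some suitably chosen subsheaf of monoids
… one may consider the same question with `(X, M_X)`.» Typed as the relation «the units presheaf `Q` of `Y` SOLVES the problem for
`P`»: their perfect multiplicatoids are isomorphic pairs. Joshi adds (l.44–47): «This is the precise version of the idea behind
Mochizuki's decoupling of addition and multiplication … This point is of course not clearly enunciated in [Mochizuki, 2021a,b,c,d]
or in [Mochizuki, 2022] and nor is the mechanism for such a claim established» — an interpretive sentence about another author's
text, quoted not typed. [claim: Joshi2024ATS3, status: disputed] -/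
def SolvesBasicProblem {X Y : Type*} [TopologicalSpace X] [TopologicalSpace Y] {F : Opens X → Type*} {G : Opens Y → Type*}
    [∀ U, CommGroup (F U)] [∀ V, CommGroup (G V)] (P : UnitsPresheaf (Opens X) F) (Q : UnitsPresheaf (Opens Y) G) : Prop :=
  Nonempty (PairIso (perfectMultiplicatoidOf P) (perfectMultiplicatoidOf Q))

/-! ## §11.4 Theorem 11.4.1 — multiplicatoids in the anabelian context -/

/-- **[J-III] Theorem 11.4.1 (p.143 l.52–64)**: «Let `k` be either a number field or a `p`-adic field for some prime `p` and let `k̄` be an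
algebraic closure of `k` and let `G_k` be the absolute Galois group of `k` computed using `k̄`. Then from the topological [group] `G_k`
one can reconstruct some isomorph of the multiplicatoid `(|Spec(k̄)|, k̄*pf)` of `k̄` and this reconstruction is functorial in `k`. In
other words, `(|Spec(k̄)|, k̄*pf)` is amphoric.» (Context l.48–51: «a reformulation of the classical anabelian reconstruction results for
number fields and `p`-adic fields ([Hoshi, 2015], [Hoshi, 2021])».) Typed over a family of such fields `k_i` with absolute Galois
groups `G i` (topological groups) and algebraic closures `Kbar i`, as the AMPHORICITY core: an isomorphism of topological groups
`G_{k_i} ≃ G_{k_j}` yields an isomorphism of the field multiplicatoids `k̄_i*pf ≃ k̄_j*pf` (the one-point spaces match trivially);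
«functorial in `k`» is not typed beyond this. A `Prop`-valued definition, NOT asserted (mono-anabelian reconstruction of `k̄^×`
from `G_k`: [AbsTopIII]/[Hoshi]; Neukirch–Uchida for number fields — not imported here). -/
@[claim "Joshi2024ATS3" "disputed"]
def Thm1141 {ι : Type*} (G : ι → Type*) [∀ i, Group (G i)] [∀ i, TopologicalSpace (G i)] (Kbar : ι → Type*)
    [∀ i, Field (Kbar i)] : Prop :=
  ∀ i j : ι, Nonempty (G i ≃ₜ* G j) → Nonempty (fieldMultiplicatoid (Kbar i) ≃* fieldMultiplicatoid (Kbar j))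

/-- Thm. 11.4.1 as typed is automatic on the diagonal (`i = j`): the content is entirely in `i ≠ j` with `G_{k_i} ≃ G_{k_j}`.
[folklore] -/
theorem thm1141_refl {ι : Type*} (G : ι → Type*) [∀ i, Group (G i)] [∀ i, TopologicalSpace (G i)] (Kbar : ι → Type*)
    [∀ i, Field (Kbar i)] (i : ι) : Nonempty (fieldMultiplicatoid (Kbar i) ≃* fieldMultiplicatoid (Kbar i)) :=
  ⟨MulEquiv.refl _⟩

/-! ## §11.7 Theorem 11.7.1 — multiplicatoids from perfectoid spaces -/

section Perfectoid

/-! The abstract UNTILT-CLASS datum §11.7 reads (parameters, no instance fields): an index type `U` of the untilts `(Y, O_Y)` of a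
fixed tilt `(X♭, O_{X♭})` — perfectoid spaces over an algebraically closed perfectoid field (p.144 l.13–15); their underlying spaces
`sp u`; the presheaves `M u V = (lim←_{x ↦ x^p} O_Y)(V)` of `p`-PERFECT MULTIPLICATIVE MONOIDS (display (11.7.2); NB the `p`-perfection
`lim_{x↦x^p}`, not the full perfection `lim_n` of §11.1 — Rmk. 11.8.1 (2) says it «plays a role similar to» the multiplicatoid sheaf);
the étale fundamental groups `π1 u` for chosen geometric basepoints; and the relation `IsoSp u v` «`(X, O_X)` and `(Y, O_Y)` are
isomorphic perfectoid spaces». Mathlib offers the tilt of a perfectoid FIELD only (`PreTilt`); nothing here is constructed. -/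

variable (U : Type*) (sp : U → Type*) [∀ u, TopologicalSpace (sp u)] (M : ∀ u, Opens (sp u) → Type*)
  [∀ u V, CommMonoid (M u V)] (π1 : U → Type*) [∀ u, Group (π1 u)] (IsoSp : U → U → Prop)

/-- **[J-III] Thm. 11.7.1 (1) (p.144 l.16–22, display (11.7.2))**: for two untilts `X`, `Y` of the same tilt «one has a homeomorphism of pairs
consisting of a topological space and a sheaf of `p`-perfect multiplicative monoids `(|Y|, lim←_{x↦x^p} O_Y) ≃ (|X|, lim←_{x↦x^p} O_X)`» (proof:
[Scholze 2012, Thm. 1.8] `O_{X♭} = lim←_{x↦x^p} O_X` (11.7.4) and [Scholze 2012, Thm. 6.2] `|X| ≃ |X♭|` (11.7.5), so the pair's isomorphism class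
depends only on `X♭`, (11.7.6)). Typed: a homeomorphism `h : |X| ≃ |Y|` with monoid isomorphisms of sections over `V ⊂ |Y|` and
`h⁻¹V ⊂ |X|`. NOT asserted. -/
@[claim "Joshi2024ATS3" "disputed"]
def Thm1171_1 : Prop :=
  ∀ u v : U, ∃ h : sp u ≃ₜ sp v, ∀ V : Opens (sp v), Nonempty (M v V ≃* M u (Opens.comap (h : C(sp u, sp v)) V))

/-- **[J-III] Thm. 11.7.1 (2) (p.144 l.23–24)**: «there exists pairs `(X, O_X)` of perfectoid spaces which are not isomorphic, but for which the
above isomorphism holds» (proof, p.145 l.10–13: «two perfectoid spaces with isomorphic tilts need not be isomorphic … in the case `X`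
arises from a perfectoid field, by the main theorem of [Kedlaya and Temkin, 2018]»). Typed: the untilt class contains two members
that are NOT isomorphic as perfectoid spaces (the abstract relation `IsoSp`) while (1) holds for them. (The existence of distinct
untilts is also [J-I]'s theme — slot E-t1's `ArithTeichmullerSpace.lean`; not restated: `IsoSp` is a parameter.) NOT asserted. -/
@[claim "Joshi2024ATS3" "disputed"]
def Thm1171_2 : Prop :=
  ∃ u v : U, ¬ IsoSp u v ∧
    ∃ h : sp u ≃ₜ sp v, ∀ V : Opens (sp v), Nonempty (M v V ≃* M u (Opens.comap (h : C(sp u, sp v)) V))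

/-- **[J-III] Thm. 11.7.1 (3) (p.144 l.25–29, display (11.7.3))**: «for a suitable choice of geometric basepoints, one has an isomorphism of étale
fundamental groups `π₁^ét(X) ≃ π₁^ét(Y)`» (proof, p.145 l.14–16: [Scholze 2012, Thm. 7.12] `π₁^ét(X) ≃ π₁^ét(X♭)`). Typed as an
isomorphism of abstract groups for the chosen basepoints. NOT asserted. -/
@[claim "Joshi2024ATS3" "disputed"]
def Thm1171_3 : Prop := ∀ u v : U, Nonempty (π1 u ≃* π1 v)

/-- **[J-III] Theorem 11.7.1 (p.144 l.13–29)** = (1) ∧ (2) ∧ (3). NOT asserted. -/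
@[claim "Joshi2024ATS3" "disputed"]
def Thm1171 : Prop := Thm1171_1 U sp M ∧ Thm1171_2 U sp M IsoSp ∧ Thm1171_3 U π1

/-- (2) implies the untilt class has at least two members that the relation `IsoSp` separates — so (2) is FALSE for any reflexive
`IsoSp` on a class with one untilt: the typed statement is contentful exactly through [Kedlaya–Temkin 2018]'s input. [folklore] -/
theorem thm1171_2_nontrivial (hrefl : ∀ u, IsoSp u u) (h : Thm1171_2 U sp M IsoSp) : ∃ u v : U, u ≠ v := by
  obtain ⟨u, v, hne, -⟩ := h
  exact ⟨u, v, fun huv => hne (huv ▸ hrefl u)⟩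

/-- (1) on the diagonal holds trivially (identity homeomorphism, identity isomorphisms) — the content of (1) is off-diagonal. [folklore] -/
theorem thm1171_1_diag (u : U) :
    ∃ h : sp u ≃ₜ sp u, ∀ V : Opens (sp u), Nonempty (M u V ≃* M u (Opens.comap (h : C(sp u, sp u)) V)) :=
  ⟨Homeomorph.refl _, fun V => ⟨by rw [show Opens.comap ((Homeomorph.refl (sp u) : C(sp u, sp u))) V = V from
    Opens.ext rfl]⟩⟩

end Perfectoid

/-! ## §11.5, §11.6, Remarks 11.1.2, 11.8.1–11.8.3 (READING; quoted, not typed)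
* Rmk. 11.1.2 (p.142 l.40–45): «the pairs `(X, O*pf_X)` (resp. `(X, O*pf_X)` [sic — the second should read `(X, (O_X,+)pf)`]) … exist even if
  `X` does not admit a perfectoidification in the sense of [Scholze, 2012].»
* §11.5 (p.144 l.1–4): the decoupling is algebraised by monoid formal group laws [Joshi 2019]; precise version [J-2½] = arXiv
  2305.10398 Thm. 3.4.1 (cross-citation only).
* §11.6 (p.144 l.5–9): «the existence of distinct schemes `(Y, O_Y)` in (11.3.1) is difficult to establish convincingly if one works with
  the category of schemes (as Mochizuki does) … For [IUTchI–IV], one needs a precise quantification of what “some” means in the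
  above theorem [11.4.1]» — interpretive; E6-style attach point, no side taken.
* Rmk. 11.8.1 (p.145 l.18–23): (1) «So one has a non-trivial solutions to the above problem in the category of perfectoid spaces»
  (an inference from Thm. 11.7.1 (1)+(2) with «scheme» replaced by «perfectoid space» and `O*pf` by the `p`-perfection — analogy level,
  as E-t39 notes); (2) «the sheaf `O_{X♭} = lim←_{x↦x^p} O_X` plays a role similar to the sheaf encapsulating the multiplicatoid».
* Rmk. 11.8.2 (p.145 l.24–31): Joshi works with Berkovich analytic spaces, where «logarithms of invertible functions are available
  and one can recover the additive structure … from the multiplicative datum `O*pf_X` … one may treat the additive and multiplicative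
  structure as being interchangeable» — methodological; thematic neighbour of our log-link vocabulary only, no binding.
* Rmk. 11.8.3 (p.145 l.32–40): «the perfect multiplicatoid (11.3.1) exists for any scheme `X`. But as has been remarked in [Scholze,
  2014], the ‘perfectoidification’ of a hyperbolic curve does not exist … Hence, the theory of pairs (11.3.1) implicit in [Mochizuki,
  2008] is at once more general but at the same time weaker than the theory of perfectoid spaces» — comparative; the factual kernel
  «exists for any scheme» is the construction `perfectMultiplicatoidOf` (defined for every units presheaf). -/

end Summit.ABC.IUTFork.Joshi.ATS3.Multiplicatoids

end
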